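import Summits.QuantumAdvantage.QuantumAdvantage.Theorems.WbwObfuscatedGluedTreesKowRiVocabulary
import Summits.QuantumAdvantage.QuantumAdvantage.Theorems.WbwObfuscatedGluedTreesKowBbFibre
import Literature.Combinatorics.Enumerative.PermPrescribed

/-!
# Auxiliary counting lemmas for stub `stub_lr4Ratio` (Luby–Rackoff, four rounds, coefficient-H form)
# (crux `WbwObfuscatedGluedTrees`, stmt-QuantumAdvantage-2340; line `knowledge-of-walk-split`, stage 6: real→ideal
# statistical layer)

Generic finite counting used by the registered stub `stub_lr4Ratio` of the stage-6 skeleton (target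
`…KnowledgeOfWalkSplit.RealIdeal.IdealCodeSoundness`), kept apart from the Feistel-specific count:

* §1 `xorVec` algebra (solving `a ⊕ b = d`; `· ⊕ c` is injective);
* §2 pair collisions of the ROUND-INPUT MAP `(w, v) ↦ w ⊕ f v` of a uniformly random round function `f`: two distinct
  points `(w, v) ≠ (w', v')` collide for at most a `2^{-m}` fraction of the `f` (never if `v = v'`, for exactly
  `|F|/2^m` functions otherwise — a two-point cylinder per value of `f v`), and the union bound over the ordered
  pairs of an injective finite family (`card_biUnion_coll_mul_le`) — the four-round analogue of
  `LubyRackoff.card_coll_pair_mul_le` / `card_G1_compl_mul_le` of `LubyRackoffIdealProofs.lean`;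
* §3 the cylinder probability of a uniformly random PERMUTATION: prescribing injective values at `k` points leaves
  `(N − k)!` permutations (`Literature.Combinatorics.Enumerative.card_permsPrescribed`), i.e. probability `1/(N)_k`
  (`finProb_perm_prescribed`);
* §4 the falling-factorial arithmetic `N^k (1 − k(k−1)/N) ≤ (N)_k` (`toolkit_riLr4RatioAux`, the registered helper
  stub of this file).
-/

set_option linter.dupNamespace false

noncomputable section

namespace Summit.QuantumAdvantage.QuantumAdvantage.Theorems.WbwObfuscatedGluedTrees.KnowledgeOfWalk.RealIdeal

open Finset
open Literature.Computability.Complexity Literature.Computability.QuantumComplexity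
open Literature.Computability.QuantumComplexity.GluedTrees
open Literature.Computability.Cryptography Literature.Computability.Cryptography.ObfuscatedGluedTrees
open Literature.Computability.Cryptography.LubyRackoff
open Summit.QuantumAdvantage.QuantumAdvantage.Theorems.WbwObfuscatedGluedTrees.KnowledgeOfWalk.BlackBox

/-! ## §1 `xorVec` algebra -/

/-- Solving `a ⊕ b = d` for `b`: `b = a ⊕ d`. [folklore] -/
theorem xorVec_eq_iff {m : ℕ} (a b d : Fin m → Bool) : xorVec a b = d ↔ b = xorVec a d := by
  constructor
  · rintro rfl; rw [xorVec_xorVec_cancel_left]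
  · rintro rfl; rw [xorVec_xorVec_cancel_left]

/-- `· ⊕ c` is injective. [folklore] -/
theorem xorVec_right_injective {m : ℕ} (c : Fin m → Bool) : Function.Injective fun a => xorVec a c :=
  fun a a' h => by
    have := congrArg (fun x => xorVec x c) h
    simpa only [xorVec_xorVec_cancel] using this

/-! ## §2 Pair collisions of the round-input map `(w, v) ↦ w ⊕ f v` -/

section Mix

variable {m : ℕ} {V : Type} [Fintype V] [DecidableEq V]

/-- **One pair**: two distinct points `u = (w, v) ≠ u' = (w', v')` collide under the round-input map `w ⊕ f v` for
at most a `2^{-m}` fraction of the round functions `f` — never if `v = v'` (then `w ≠ w'`), and for exactly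
`|F|/2^m` functions otherwise (`f v' = w' ⊕ (w ⊕ f v)`: a two-point cylinder for each value of `f v`).
[cite: LubyRackoff1988, Theorem 1 (proof)] -/
theorem card_coll_pair_mul_le (u u' : (Fin m → Bool) × V) (hne : u ≠ u') :
    (univ.filter fun f : V → (Fin m → Bool) => xorVec u.1 (f u.2) = xorVec u'.1 (f u'.2)).card *
        Fintype.card (Fin m → Bool) ≤ Fintype.card (V → (Fin m → Bool)) := by
  by_cases hv : u.2 = u'.2
  · have h0 : (univ.filter fun f : V → (Fin m → Bool) => xorVec u.1 (f u.2) = xorVec u'.1 (f u'.2)) = ∅ := by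
      refine filter_eq_empty_iff.2 fun f _ h => hne ?_
      rw [← hv] at h
      exact Prod.ext (xorVec_right_injective _ h) hv
    rw [h0, card_empty, zero_mul]
    exact Nat.zero_le _
  · -- fibrewise over `c = f u.2`; each fibre is a two-point cylinder
    set C := (univ.filter fun f : V → (Fin m → Bool) => xorVec u.1 (f u.2) = xorVec u'.1 (f u'.2)) with hC
    have hfib := card_eq_sum_card_fiberwise (f := fun f : V → (Fin m → Bool) => f u.2) (s := C) (t := univ)
      (fun _ _ => mem_coe.2 (mem_univ _))
    have hcyl : ∀ c : Fin m → Bool, (C.filter fun f : V → (Fin m → Bool) => f u.2 = c).card *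
        Fintype.card (Fin m → Bool) ^ 2 = Fintype.card (V → (Fin m → Bool)) := by
      intro c
      have h := card_filter_pins_mul (univ : Finset Bool) (fun t => if t then u.2 else u'.2)
        (fun t => if t then c else xorVec u'.1 (xorVec u.1 c)) (by
          intro b₁ _ b₂ _ h
          cases b₁ <;> cases b₂ <;> simp_all [eq_comm])
      rw [card_univ, Fintype.card_bool] at h
      rw [← h]
      congr 2
      ext f
      simp only [hC, mem_filter, mem_univ, true_and, forall_const, Bool.forall_bool, if_true, if_false,
        Bool.false_eq_true]
      constructor
      · rintro ⟨h1, h2⟩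
        refine ⟨?_, h2⟩
        rw [h2] at h1
        exact (xorVec_eq_iff _ _ _).1 h1.symm
      · rintro ⟨h1, h2⟩
        refine ⟨?_, h2⟩
        rw [h2, h1, xorVec_xorVec_cancel_left]
    have hpos : 0 < Fintype.card (Fin m → Bool) := Fintype.card_pos
    have key : C.card * Fintype.card (Fin m → Bool) ^ 2 =
        Fintype.card (Fin m → Bool) * Fintype.card (V → (Fin m → Bool)) := by
      rw [hfib, sum_mul, sum_congr rfl fun c _ => hcyl c, sum_const, card_univ, smul_eq_mul]
    have key' : Fintype.card (Fin m → Bool) * (C.card * Fintype.card (Fin m → Bool)) =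
        Fintype.card (Fin m → Bool) * Fintype.card (V → (Fin m → Bool)) := by
      rw [← key]; ring
    exact (Nat.eq_of_mul_eq_mul_left hpos key').le

variable {ι : Type}

/-- **Union bound over ordered pairs**: the round functions producing SOME collision of the round-input map on an
injective finite family of points `u : ι → {0,1}^m × V` are at most a `|S|(|S|−1)/2^m` fraction.
[cite: LubyRackoff1988, Theorem 1 (proof)] -/
theorem card_biUnion_coll_mul_le (S : Finset ι) (u : ι → (Fin m → Bool) × V) (hu : Set.InjOn u S) :
    (S.offDiag.biUnion fun p => univ.filter fun f : V → (Fin m → Bool) =>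
        xorVec (u p.1).1 (f (u p.1).2) = xorVec (u p.2).1 (f (u p.2).2)).card * Fintype.card (Fin m → Bool) ≤
      S.offDiag.card * Fintype.card (V → (Fin m → Bool)) := by
  calc (S.offDiag.biUnion fun p => univ.filter fun f : V → (Fin m → Bool) =>
          xorVec (u p.1).1 (f (u p.1).2) = xorVec (u p.2).1 (f (u p.2).2)).card * Fintype.card (Fin m → Bool)
      ≤ (∑ p ∈ S.offDiag, (univ.filter fun f : V → (Fin m → Bool) =>
          xorVec (u p.1).1 (f (u p.1).2) = xorVec (u p.2).1 (f (u p.2).2)).card) * Fintype.card (Fin m → Bool) :=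
        Nat.mul_le_mul_right _ card_biUnion_le
    _ = ∑ p ∈ S.offDiag, (univ.filter fun f : V → (Fin m → Bool) =>
          xorVec (u p.1).1 (f (u p.1).2) = xorVec (u p.2).1 (f (u p.2).2)).card * Fintype.card (Fin m → Bool) :=
        sum_mul _ _ _
    _ ≤ ∑ _p ∈ S.offDiag, Fintype.card (V → (Fin m → Bool)) :=
        sum_le_sum fun p hp => card_coll_pair_mul_le _ _ fun h =>
          (mem_offDiag.1 hp).2.2 (hu (mem_offDiag.1 hp).1 (mem_offDiag.1 hp).2.1 h)
    _ = S.offDiag.card * Fintype.card (V → (Fin m → Bool)) := by rw [sum_const, smul_eq_mul]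

/-- A round function whose round-input map is NOT injective on the family lies in the union of the pair events.
[folklore] -/
theorem mem_biUnion_coll_of_not_injOn (S : Finset ι) (u : ι → (Fin m → Bool) × V) (f : V → (Fin m → Bool))
    (h : ¬ Set.InjOn (fun i => xorVec (u i).1 (f (u i).2)) S) :
    f ∈ S.offDiag.biUnion fun p => univ.filter fun f : V → (Fin m → Bool) =>
      xorVec (u p.1).1 (f (u p.1).2) = xorVec (u p.2).1 (f (u p.2).2) := by
  rw [Set.InjOn] at h
  push Not at h
  obtain ⟨i, hi, j, hj, hij, hne⟩ := h
  exact mem_biUnion.2 ⟨(i, j), mem_offDiag.2 ⟨mem_coe.1 hi, mem_coe.1 hj, hne⟩, mem_filter.2 ⟨mem_univ _, hij⟩⟩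

end Mix

/-! ## §3 The cylinder probability of a uniformly random permutation -/

/-- **Prescribing injective values at `k` points**: `Pr_π[π x = g₀ x for x ∈ D] = 1/(N)_k` for a uniformly random
permutation `π` of a finite type with `N` elements, `k = |D|`, `g₀` injective on `D` (the `(N − k)!` extensions,
`card_permsPrescribed`, against `N! = (N − k)! · (N)_k`). [folklore] -/
theorem finProb_perm_prescribed {α : Type} [Fintype α] [DecidableEq α] (D : Finset α) (g₀ : α → α)
    (hg : Set.InjOn g₀ D) :
    finProb (PMF.uniformOfFintype (Equiv.Perm α)) (fun π => ∀ x ∈ D, π x = g₀ x) =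
      1 / ((Fintype.card α).descFactorial D.card : ℝ) := by
  have hk : D.card ≤ Fintype.card α := card_le_univ D
  have hD : (0 : ℝ) < (Fintype.card α).descFactorial D.card := by
    exact_mod_cast Nat.pos_of_ne_zero (mt Nat.descFactorial_eq_zero_iff_lt.1 (not_lt.2 hk))
  have hF : (0 : ℝ) < (Fintype.card α).factorial := by exact_mod_cast Nat.factorial_pos _
  have key : (univ.filter fun π : Equiv.Perm α => ∀ x ∈ D, π x = g₀ x).card *
      (Fintype.card α).descFactorial D.card = (Fintype.card α).factorial := by
    have hc : (univ.filter fun π : Equiv.Perm α => ∀ x ∈ D, π x = g₀ x).card =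
        (Fintype.card α - D.card).factorial :=
      Literature.Combinatorics.Enumerative.card_permsPrescribed D hg
    rw [hc]
    exact Nat.factorial_mul_descFactorial hk
  rw [finProb_uniform, Fintype.card_perm, div_eq_div_iff hF.ne' hD.ne', one_mul]
  exact_mod_cast key

/-! ## §4 Falling factorials against powers -/

/-- Registered helper stub of crux stmt-QuantumAdvantage-2340 (aux file for `stub_lr4Ratio`): the permutation/function
gap of `k` cylinder constraints, `N^k · (1 − k(k−1)/N) ≤ (N)_k` for `k ≤ N`
(so `1/(N)_k ≤ (1 − k(k−1)/N)⁻¹ · N^{−k}`). [folklore] -/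
theorem toolkit_riLr4RatioAux : ∀ (N k : ℕ), k ≤ N →
    (N : ℝ) ^ k * (1 - (k : ℝ) * ((k : ℝ) - 1) / N) ≤ (N.descFactorial k : ℝ) := by
  intro N k
  induction k with
  | zero => intro; simp
  | succ k ih =>
    intro hk
    have hk' : k ≤ N := Nat.le_of_succ_le hk
    have hN : (0 : ℝ) < N := by exact_mod_cast lt_of_lt_of_le (Nat.succ_pos k) hk
    have hNk : (0 : ℝ) ≤ (N : ℝ) - k := by
      have : (k : ℝ) ≤ N := by exact_mod_cast hk'
      linarith
    have hkk : (0 : ℝ) ≤ (k : ℝ) * ((k : ℝ) - 1) := cast_mul_pred_nonneg k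
    rw [Nat.descFactorial_succ, Nat.cast_mul, Nat.cast_sub hk']
    push_cast
    calc (N : ℝ) ^ (k + 1) * (1 - ((k : ℝ) + 1) * ((k : ℝ) + 1 - 1) / N)
        ≤ ((N : ℝ) - k) * ((N : ℝ) ^ k * (1 - (k : ℝ) * ((k : ℝ) - 1) / N)) := by
          have key : ((N : ℝ) - k) * ((N : ℝ) ^ k * (1 - (k : ℝ) * ((k : ℝ) - 1) / N)) -
              (N : ℝ) ^ (k + 1) * (1 - ((k : ℝ) + 1) * ((k : ℝ) + 1 - 1) / N) =
                (N : ℝ) ^ k * ((k : ℝ) + (k : ℝ) * ((k : ℝ) * ((k : ℝ) - 1)) / N) := by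
            field_simp
            ring
          have hnn : (0 : ℝ) ≤ (N : ℝ) ^ k * ((k : ℝ) + (k : ℝ) * ((k : ℝ) * ((k : ℝ) - 1)) / N) :=
            mul_nonneg (pow_nonneg hN.le k)
              (add_nonneg (Nat.cast_nonneg k) (div_nonneg (mul_nonneg (Nat.cast_nonneg k) hkk) hN.le))
          rw [← key] at hnn
          exact sub_nonneg.1 hnn
      _ ≤ ((N : ℝ) - k) * (N.descFactorial k : ℝ) := mul_le_mul_of_nonneg_left (ih hk') hNk

end Summit.QuantumAdvantage.QuantumAdvantage.Theorems.WbwObfuscatedGluedTrees.KnowledgeOfWalk.RealIdeal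

end
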